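import HarnessLib
import Literature.NumberTheory.LFunctions.WeilPositivityCertificate
import Summits.RiemannHypothesis.RiemannHypothesis.Theorems.SignConePointwiseChecker

/-!
# Route SignCone: Dirichlet-SOS tail bounds for the comb of a pointwise certificate

Support for the unconditional rungs of `SignConeOscillatory` / `SignConeInequality`
(items stmt-RiemannHypothesis-16302 / 16301). In the pointwise certificates the density
`F(y) = Re ψ(1/4+iy/2) − log π + s + Ê_χ(y) − comb(y)`, `comb(y) = Σ_n a_n cos(y log n)`, must be checked
on a grid up to the tail closure `Y₀ ≈ 2·exp(Σ a_n)`: beyond the grid only `cos ≤ 1` is available. But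
a frequency `x` with `|x| > 2b` pairs to ZERO with every autocorrelation `G` supported in `[-2b, 2b]`, so
any even trigonometric sum `H` with such frequencies may be added to the density. This file certifies
bounds of the form

  `comb(y) − H(y) ≤ M`  for all real `y`,

with `M` much smaller than `Σ a_n`, from an INTEGER GRAM CERTIFICATE: rows `r_i ∈ ℤ^{Np}` give the
non-negative Dirichlet squares `Σ_i |Σ_{n ≤ Np} r_{i,n} n^{iy}|² = Σ_{n,m} G_{nm} cos(y log(n/m))`,
`G = Σ_i r_i r_iᵀ`; grouping the pairs `(n, m)` by the reduced ratio `p/q` (`cos(y log(tp/tq)) = cos(y log(p/q))`)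
gives class sums `C_{pq}`; the classes with `p/q` or `q/p ≥ T > e^{2b}` form `H`, and
`M = Σ_{other classes} |C_{pq}/4^S + a_{pq}/2|` (`a_{n1} = a_{1n} = a_n`, zero otherwise) works, because
`comb − H = Σ_in (a/2 + C/4^S) cos − (squares) ≤ Σ_in |a/2 + C/4^S|`. No positive-semidefiniteness and no
exact coefficient matching are needed; rounding defects are absorbed into `M`.

This file: Dirichlet squares (`normSq_sum_ofReal_mul_exp`, `dirichletSquare_nonneg`), the regrouping of
pairs by reduced ratio (`ratioSigma`, `sum_pairs_eq_sum_ratioSigma`, `ratioClasses`), the data `SOSData`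
with the computable `gram / classSum / isOut / acoef / sosBound / checkSOS` and the real `Hsos`, and the
non-negative class expansion `classSum_expansion_nonneg`. The bound `comb_sub_Hsos_le` is in
`SignConePointwiseSOSTailBound.lean`.
-/

noncomputable section

-- `Summit.RiemannHypothesis.RiemannHypothesis.…` repeats a namespace component by design (D-0017 layout).
set_option linter.dupNamespace false

open Real Finset

namespace Summit.RiemannHypothesis.RiemannHypothesis.Theorems.SignCone

open Literature.Analysis.ValidatedNumerics.Numerics Literature.NumberTheory.LFunctions

/-! ## Dirichlet squares -/

/-- `|Σ_j c_j e^{iθ_j}|² = Σ_j Σ_l c_j c_l cos(θ_j − θ_l)` for real coefficients. [folklore] -/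
theorem normSq_sum_ofReal_mul_exp {ι : Type*} (s : Finset ι) (c θ : ι → ℝ) :
    Complex.normSq (∑ j ∈ s, (c j : ℂ) * Complex.exp ((θ j : ℂ) * Complex.I)) =
      ∑ j ∈ s, ∑ l ∈ s, c j * c l * Real.cos (θ j - θ l) := by
  set z : ι → ℂ := fun j => (c j : ℂ) * Complex.exp ((θ j : ℂ) * Complex.I) with hz
  have h1 : (Complex.normSq (∑ j ∈ s, z j) : ℂ) = (∑ j ∈ s, z j) * (starRingEnd ℂ) (∑ l ∈ s, z l) := by
    rw [Complex.mul_conj]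
  have h2 : (∑ j ∈ s, z j) * (starRingEnd ℂ) (∑ l ∈ s, z l) = ∑ j ∈ s, ∑ l ∈ s, z j * (starRingEnd ℂ) (z l) := by
    rw [map_sum, Finset.sum_mul_sum]
  have h3 : ∀ j l, z j * (starRingEnd ℂ) (z l) = ((c j * c l * Real.cos (θ j - θ l) : ℝ) : ℂ) +
      ((c j * c l * Real.sin (θ j - θ l) : ℝ) : ℂ) * Complex.I := by
    intro j l
    simp only [hz, map_mul, Complex.conj_ofReal, ← Complex.exp_conj, map_mul, Complex.conj_I,
      mul_neg]
    have : Complex.exp ((θ j : ℂ) * Complex.I) * Complex.exp (-((θ l : ℂ) * Complex.I)) =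
        Complex.exp (((θ j - θ l : ℝ) : ℂ) * Complex.I) := by
      rw [← Complex.exp_add]; congr 1; push_cast; ring
    calc (c j : ℂ) * Complex.exp ((θ j : ℂ) * Complex.I) * ((c l : ℂ) * Complex.exp (-((θ l : ℂ) * Complex.I)))
        = (c j : ℂ) * (c l : ℂ) * (Complex.exp ((θ j : ℂ) * Complex.I) * Complex.exp (-((θ l : ℂ) * Complex.I))) := by ring
      _ = (c j : ℂ) * (c l : ℂ) * Complex.exp (((θ j - θ l : ℝ) : ℂ) * Complex.I) := by rw [this]
      _ = _ := by
        rw [Complex.exp_mul_I]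
        rw [← Complex.ofReal_cos, ← Complex.ofReal_sin]
        push_cast
        ring
  have h4 : ((Complex.normSq (∑ j ∈ s, z j) : ℝ) : ℂ) =
      ((∑ j ∈ s, ∑ l ∈ s, c j * c l * Real.cos (θ j - θ l) : ℝ) : ℂ) +
        ((∑ j ∈ s, ∑ l ∈ s, c j * c l * Real.sin (θ j - θ l) : ℝ) : ℂ) * Complex.I := by
    rw [h1, h2]
    simp_rw [h3]
    rw [Finset.sum_comm]
    push_cast
    simp_rw [Finset.sum_add_distrib, Finset.sum_mul]
    rw [Finset.sum_comm]
    congr 1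
    rw [Finset.sum_comm]
  have h5 := congrArg Complex.re h4
  simp only [Complex.ofReal_re, Complex.add_re, Complex.mul_re, Complex.ofReal_im, Complex.I_re,
    Complex.I_im, mul_zero, mul_one, add_zero, sub_self] at h5
  rw [hz] at h5
  exact h5

/-- **Non-negativity of a Dirichlet square**: `0 ≤ Σ_j Σ_l c_j c_l cos(θ_j − θ_l)`. [folklore] -/
theorem dirichletSquare_nonneg {ι : Type*} (s : Finset ι) (c θ : ι → ℝ) :
    0 ≤ ∑ j ∈ s, ∑ l ∈ s, c j * c l * Real.cos (θ j - θ l) := by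
  rw [← normSq_sum_ofReal_mul_exp]
  exact Complex.normSq_nonneg _

/-! ## Regrouping pairs `(n, m) ∈ [1, N]²` by reduced ratio -/

/-- The index set of reduced ratios with their multipliers:
`{((p, q), t) : 1 ≤ p, q ≤ N, gcd(p, q) = 1, 1 ≤ t ≤ N / max p q}`. [folklore] -/
def ratioSigma (N : ℕ) : Finset ((ℕ × ℕ) × ℕ) :=
  (((Icc 1 N ×ˢ Icc 1 N).filter fun pq => Nat.Coprime pq.1 pq.2).sigma fun pq => Icc 1 (N / max pq.1 pq.2)).map
    (Equiv.sigmaEquivProd (ℕ × ℕ) ℕ).toEmbedding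

/-- Membership in `ratioSigma`. [folklore] -/
theorem mem_ratioSigma {N : ℕ} {x : (ℕ × ℕ) × ℕ} :
    x ∈ ratioSigma N ↔ (1 ≤ x.1.1 ∧ x.1.1 ≤ N) ∧ (1 ≤ x.1.2 ∧ x.1.2 ≤ N) ∧ Nat.Coprime x.1.1 x.1.2 ∧
      1 ≤ x.2 ∧ x.2 ≤ N / max x.1.1 x.1.2 := by
  rcases x with ⟨⟨p, q⟩, t⟩
  simp only [ratioSigma, Finset.mem_map, Finset.mem_sigma, Finset.mem_filter, Finset.mem_product,
    Finset.mem_Icc, Equiv.toEmbedding_apply]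
  constructor
  · rintro ⟨⟨⟨p', q'⟩, t'⟩, ⟨⟨⟨hp, hq⟩, hc⟩, ht⟩, he⟩
    simp only [Equiv.sigmaEquivProd, Equiv.coe_fn_mk, Prod.mk.injEq] at he
    obtain ⟨⟨rfl, rfl⟩, rfl⟩ := he
    exact ⟨hp, hq, hc, ht⟩
  · rintro ⟨hp, hq, hc, ht⟩
    exact ⟨⟨⟨p, q⟩, t⟩, ⟨⟨⟨hp, hq⟩, hc⟩, ht⟩, rfl⟩

/-- **Regrouping by reduced ratio.** The sum of `F n m` over `[1, N]²` equals the sum of `F (tp) (tq)`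
over reduced ratios `(p, q)` and multipliers `t` (the bijection `(n, m) ↦ ((n/d, m/d), d)`, `d = gcd n m`). [folklore] -/
theorem sum_pairs_eq_sum_ratioSigma {α : Type*} [AddCommMonoid α] (N : ℕ) (F : ℕ → ℕ → α) :
    ∑ nm ∈ Icc 1 N ×ˢ Icc 1 N, F nm.1 nm.2 =
      ∑ x ∈ ratioSigma N, F (x.2 * x.1.1) (x.2 * x.1.2) := by
  classical
  refine Finset.sum_nbij'
    (fun nm : ℕ × ℕ => ((nm.1 / Nat.gcd nm.1 nm.2, nm.2 / Nat.gcd nm.1 nm.2), Nat.gcd nm.1 nm.2))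
    (fun x : (ℕ × ℕ) × ℕ => (x.2 * x.1.1, x.2 * x.1.2)) ?_ ?_ ?_ ?_ ?_
  · -- lands in ratioSigma
    rintro ⟨n, m⟩ hnm
    simp only [Finset.mem_product, Finset.mem_Icc] at hnm
    obtain ⟨⟨hn1, hnN⟩, hm1, hmN⟩ := hnm
    have hd : 0 < Nat.gcd n m := Nat.gcd_pos_of_pos_left _ hn1
    have hdn : Nat.gcd n m ∣ n := Nat.gcd_dvd_left n m
    have hdm : Nat.gcd n m ∣ m := Nat.gcd_dvd_right n m
    have hn' : 0 < n / Nat.gcd n m := Nat.div_pos (Nat.le_of_dvd hn1 hdn) hd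
    have hm' : 0 < m / Nat.gcd n m := Nat.div_pos (Nat.le_of_dvd hm1 hdm) hd
    rw [mem_ratioSigma]
    dsimp only
    refine ⟨⟨hn', (Nat.div_le_self _ _).trans hnN⟩, ⟨hm', (Nat.div_le_self _ _).trans hmN⟩,
      Nat.coprime_div_gcd_div_gcd hd, hd, ?_⟩
    have hmax : 0 < max (n / Nat.gcd n m) (m / Nat.gcd n m) := lt_of_lt_of_le hn' (le_max_left _ _)
    rw [Nat.le_div_iff_mul_le hmax]
    rcases le_total (n / Nat.gcd n m) (m / Nat.gcd n m) with h | h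
    · rw [max_eq_right h, Nat.mul_comm, Nat.div_mul_cancel hdm]; exact hmN
    · rw [max_eq_left h, Nat.mul_comm, Nat.div_mul_cancel hdn]; exact hnN
  · -- inverse lands in the square
    rintro ⟨⟨p, q⟩, t⟩ hx
    rw [mem_ratioSigma] at hx
    obtain ⟨⟨hp1, hpN⟩, ⟨hq1, hqN⟩, -, ht1, htN⟩ := hx
    have hmax : 0 < max p q := lt_of_lt_of_le hp1 (le_max_left _ _)
    rw [Nat.le_div_iff_mul_le hmax] at htN
    simp only [Finset.mem_product, Finset.mem_Icc]
    refine ⟨⟨Nat.mul_pos ht1 hp1, ?_⟩, Nat.mul_pos ht1 hq1, ?_⟩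
    · exact (Nat.mul_le_mul_left t (le_max_left p q)).trans htN
    · exact (Nat.mul_le_mul_left t (le_max_right p q)).trans htN
  · -- left inverse
    rintro ⟨n, m⟩ _
    dsimp only
    rw [Nat.mul_comm (Nat.gcd n m) (n / Nat.gcd n m), Nat.div_mul_cancel (Nat.gcd_dvd_left n m),
      Nat.mul_comm (Nat.gcd n m) (m / Nat.gcd n m), Nat.div_mul_cancel (Nat.gcd_dvd_right n m)]
  · -- right inverse
    rintro ⟨⟨p, q⟩, t⟩ hx
    rw [mem_ratioSigma] at hx
    obtain ⟨⟨hp1, -⟩, ⟨hq1, -⟩, hc, ht1, -⟩ := hx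
    have hgcd : Nat.gcd (t * p) (t * q) = t := by rw [Nat.gcd_mul_left, hc, mul_one]
    dsimp only
    rw [hgcd, Nat.mul_div_cancel_left p ht1, Nat.mul_div_cancel_left q ht1]
  · -- the summands agree
    rintro ⟨n, m⟩ _
    dsimp only
    rw [Nat.mul_comm (Nat.gcd n m) (n / Nat.gcd n m), Nat.div_mul_cancel (Nat.gcd_dvd_left n m),
      Nat.mul_comm (Nat.gcd n m) (m / Nat.gcd n m), Nat.div_mul_cancel (Nat.gcd_dvd_right n m)]

/-- The reduced-ratio classes `{(p, q) ∈ [1, N]² : gcd(p, q) = 1}`. [folklore] -/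
def ratioClasses (N : ℕ) : Finset (ℕ × ℕ) := (Icc 1 N ×ˢ Icc 1 N).filter fun pq => Nat.Coprime pq.1 pq.2

/-- Sum over `ratioSigma` = sum over classes of the sum over multipliers. [folklore] -/
theorem sum_ratioSigma_eq {α : Type*} [AddCommMonoid α] (N : ℕ) (Φ : (ℕ × ℕ) × ℕ → α) :
    ∑ x ∈ ratioSigma N, Φ x = ∑ pq ∈ ratioClasses N, ∑ t ∈ Icc 1 (N / max pq.1 pq.2), Φ (pq, t) := by
  unfold ratioSigma ratioClasses
  rw [Finset.sum_map, Finset.sum_sigma]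
  rfl

/-! ## The certificate data and the computable bound -/

/-- **Data of a Dirichlet-SOS tail certificate**: Gram rows `r_i ∈ ℤ^{Np}` (scaled by `2^S`), the basis
size `Np` and the ratio threshold `T` (to be checked `> e^{L}`, `L = 2b`). [folklore] -/
structure SOSData where
  /-- basis `{1, …, Np}` -/
  Np : ℕ
  /-- the rows are `2^S ×` the real Gram factor -/
  S : ℕ
  /-- integer rows (entry `n` at index `n - 1`; missing entries read `0`) -/
  rows : List (List ℤ)
  /-- ratio threshold: classes with `p ≥ T q` or `q ≥ T p` go into `H` -/
  T : ℚ

namespace SOSData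

variable (Z : SOSData)

/-- Row entry `r_i(n)` as a rational (`n` is 1-indexed). [folklore] -/
def row (i n : ℕ) : ℚ := (((Z.rows.getD i []).getD (n - 1) 0 : ℤ) : ℚ)

/-- Gram entry `G_{nm} = Σ_i r_i(n) r_i(m)`. [folklore] -/
def gram (n m : ℕ) : ℚ := sumR Z.rows.length fun i => Z.row i n * Z.row i m

/-- Class sum `C_{pq} = Σ_{t=1}^{Np / max p q} G_{tp, tq}`. [folklore] -/
def classSum (p q : ℕ) : ℚ := sumR (Z.Np / max p q) fun t => Z.gram ((t + 1) * p) ((t + 1) * q)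

/-- The class `(p, q)` is OUT (its frequency `|log p − log q| ≥ log T`). [folklore] -/
def isOut (p q : ℕ) : Bool := decide (Z.T * q ≤ p) || decide (Z.T * p ≤ q)

/-- The comb coefficient carried by the class `(p, q)`: `a_n` on `(n, 1)` and `(1, n)`, else `0`. [folklore] -/
def acoef (nodes : List ℕ) (a : ℕ → ℚ) (p q : ℕ) : ℚ :=
  if q = 1 ∧ p ∈ nodes then a p else if p = 1 ∧ q ∈ nodes then a q else 0

/-- **The certified tail constant** `M = Σ_{in-classes} |C_{pq}/4^S + a_{pq}/2|`. [folklore] -/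
def sosBound (nodes : List ℕ) (a : ℕ → ℚ) : ℚ :=
  sumR Z.Np fun p' => sumR Z.Np fun q' =>
    if Nat.Coprime (p' + 1) (q' + 1) ∧ Z.isOut (p' + 1) (q' + 1) = false then
      |Z.classSum (p' + 1) (q' + 1) / 4 ^ Z.S + acoef nodes a (p' + 1) (q' + 1) / 2| else 0

/-- The out-of-window correction `H(y) = Σ_{out classes} (C_{pq}/4^S) cos(y (log p − log q))`. [folklore] -/
def Hsos (y : ℝ) : ℝ :=
  ∑ pq ∈ ratioClasses Z.Np, if Z.isOut pq.1 pq.2 = true then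
    ((Z.classSum pq.1 pq.2 / 4 ^ Z.S : ℚ) : ℝ) * Real.cos (y * (Real.log pq.1 - Real.log pq.2)) else 0

/-- **Checks**: every node `n` satisfies `2 ≤ n ≤ Np` and is an in-class, `0 < T`, and `e^{L} < T`
(engine enclosure of `e^{L}`). [folklore] -/
def checkSOS (nodes : List ℕ) (L : ℚ) : Bool :=
  (nodes.all fun n => decide (2 ≤ n) && decide (n ≤ Z.Np) && (Z.isOut n 1 == false)) && decide (0 < Z.T) &&
    match PW.expFI L with
    | some E => decide (E.hiQ < Z.T)
    | none => false

end SOSData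

/-! ## Soundness of the bound -/

namespace SOSData

variable {Z : SOSData}

/-- Unpacking `checkSOS`. [folklore] -/
theorem checkSOS_spec {nodes : List ℕ} {L : ℚ} (h : Z.checkSOS nodes L = true) :
    (∀ n ∈ nodes, 2 ≤ n ∧ n ≤ Z.Np ∧ Z.isOut n 1 = false) ∧ 0 < Z.T ∧ Real.exp L < Z.T := by
  unfold checkSOS at h
  simp only [Bool.and_eq_true, List.all_eq_true, decide_eq_true_eq, beq_iff_eq] at h
  obtain ⟨⟨hall, hT⟩, hexp⟩ := h
  refine ⟨fun n hn => ⟨(hall n hn).1.1, (hall n hn).1.2, (hall n hn).2⟩, hT, ?_⟩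
  split at hexp
  · rename_i E hE
    rw [decide_eq_true_eq] at hexp
    have hm := PW.mem_expFI hE
    have h1 : Real.exp L ≤ (E.hiQ : ℝ) := FI.le_hiQ hm
    have h2 : ((E.hiQ : ℚ) : ℝ) < Z.T := by exact_mod_cast hexp
    exact h1.trans_lt h2
  · simp at hexp

/-- **Out classes are out of the window**: `isOut p q` with `1 ≤ p, q` and `e^L < T` gives
`L < |log p − log q|`. [folklore] -/
theorem lt_abs_log_sub_of_isOut {L : ℚ} (hT : 0 < Z.T) (hexp : Real.exp L < Z.T) {p q : ℕ}
    (hp : 1 ≤ p) (hq : 1 ≤ q) (h : Z.isOut p q = true) :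
    (L : ℝ) < |Real.log p - Real.log q| := by
  have hp' : (0 : ℝ) < p := by exact_mod_cast hp
  have hq' : (0 : ℝ) < q := by exact_mod_cast hq
  have hT' : (0 : ℝ) < Z.T := by exact_mod_cast hT
  have hlogT : (L : ℝ) < Real.log Z.T := by
    rw [Real.lt_log_iff_exp_lt hT']; exact hexp
  unfold isOut at h
  rw [Bool.or_eq_true, decide_eq_true_eq, decide_eq_true_eq] at h
  rcases h with h | h
  · -- T q ≤ p : log p - log q ≥ log T
    have h1 : ((Z.T : ℚ) : ℝ) * q ≤ p := by exact_mod_cast h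
    have h2 : Real.log Z.T + Real.log q ≤ Real.log p := by
      rw [← Real.log_mul hT'.ne' hq'.ne']
      exact Real.log_le_log (mul_pos hT' hq') h1
    rw [← Real.log_div hp'.ne' hq'.ne'] at *
    have : (L : ℝ) < Real.log p - Real.log q := by linarith
    rw [Real.log_div hp'.ne' hq'.ne']
    exact this.trans_le (le_abs_self _)
  · have h1 : ((Z.T : ℚ) : ℝ) * p ≤ q := by exact_mod_cast h
    have h2 : Real.log Z.T + Real.log p ≤ Real.log q := by
      rw [← Real.log_mul hT'.ne' hp'.ne']
      exact Real.log_le_log (mul_pos hT' hp') h1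
    have : (L : ℝ) < Real.log q - Real.log p := by linarith
    exact this.trans_le ((le_abs_self _).trans_eq (abs_sub_comm _ _))

/-- The Dirichlet squares of the rows, summed: `SQ(y) = Σ_i |Σ_{n ≤ Np} r_i(n) n^{iy}|²` expanded and
regrouped by classes: `SQ(y) = Σ_{classes} C_{pq} cos(y(log p − log q))`, and `0 ≤ SQ(y)`. [folklore] -/
theorem classSum_expansion_nonneg (y : ℝ) :
    0 ≤ ∑ pq ∈ ratioClasses Z.Np, (Z.classSum pq.1 pq.2 : ℝ) * Real.cos (y * (Real.log pq.1 - Real.log pq.2)) := by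
  -- (1) the squares
  have hsq : ∀ i, 0 ≤ ∑ n ∈ Icc 1 Z.Np, ∑ m ∈ Icc 1 Z.Np,
      (Z.row i n : ℝ) * Z.row i m * Real.cos (y * Real.log n - y * Real.log m) :=
    fun i => dirichletSquare_nonneg (Icc 1 Z.Np) (fun n => (Z.row i n : ℝ)) (fun n => y * Real.log n)
  have hSQ : 0 ≤ ∑ i ∈ Finset.range Z.rows.length, ∑ n ∈ Icc 1 Z.Np, ∑ m ∈ Icc 1 Z.Np,
      (Z.row i n : ℝ) * Z.row i m * Real.cos (y * Real.log n - y * Real.log m) :=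
    Finset.sum_nonneg fun i _ => hsq i
  -- (2) exchange: Σ_i Σ_n Σ_m = Σ_{(n,m)} G_{nm} cos
  have hG : ∑ i ∈ Finset.range Z.rows.length, ∑ n ∈ Icc 1 Z.Np, ∑ m ∈ Icc 1 Z.Np,
      (Z.row i n : ℝ) * Z.row i m * Real.cos (y * Real.log n - y * Real.log m) =
      ∑ nm ∈ Icc 1 Z.Np ×ˢ Icc 1 Z.Np, (Z.gram nm.1 nm.2 : ℝ) * Real.cos (y * (Real.log nm.1 - Real.log nm.2)) := by
    rw [Finset.sum_comm]
    rw [Finset.sum_product]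
    refine Finset.sum_congr rfl fun n _ => ?_
    rw [Finset.sum_comm]
    refine Finset.sum_congr rfl fun m _ => ?_
    unfold gram
    rw [sumR_eq_sum]
    push_cast
    rw [Finset.sum_mul]
    refine Finset.sum_congr rfl fun i _ => ?_
    ring_nf
  -- (3) regroup by classes
  have hR := sum_pairs_eq_sum_ratioSigma Z.Np
    (fun n m => (Z.gram n m : ℝ) * Real.cos (y * (Real.log n - Real.log m)))
  have hlog : ∀ x ∈ ratioSigma Z.Np, (Z.gram (x.2 * x.1.1) (x.2 * x.1.2) : ℝ) *
      Real.cos (y * (Real.log ((x.2 * x.1.1 : ℕ) : ℝ) - Real.log ((x.2 * x.1.2 : ℕ) : ℝ))) =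
      (Z.gram (x.2 * x.1.1) (x.2 * x.1.2) : ℝ) * Real.cos (y * (Real.log x.1.1 - Real.log x.1.2)) := by
    intro x hx
    rw [mem_ratioSigma] at hx
    obtain ⟨⟨hp1, -⟩, ⟨hq1, -⟩, -, ht1, -⟩ := hx
    have hp : (0 : ℝ) < x.1.1 := by exact_mod_cast hp1
    have hq : (0 : ℝ) < x.1.2 := by exact_mod_cast hq1
    have ht : (0 : ℝ) < x.2 := by exact_mod_cast ht1
    congr 2
    push_cast
    rw [Real.log_mul ht.ne' hp.ne', Real.log_mul ht.ne' hq.ne']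
    ring
  rw [Finset.sum_congr rfl hlog, sum_ratioSigma_eq] at hR
  -- (4) the inner sums over t are the class sums
  have hC : ∀ pq ∈ ratioClasses Z.Np, ∑ t ∈ Icc 1 (Z.Np / max pq.1 pq.2),
      (Z.gram (t * pq.1) (t * pq.2) : ℝ) * Real.cos (y * (Real.log pq.1 - Real.log pq.2)) =
      (Z.classSum pq.1 pq.2 : ℝ) * Real.cos (y * (Real.log pq.1 - Real.log pq.2)) := by
    intro pq _
    rw [← Finset.sum_mul]
    congr 1
    unfold classSum
    rw [sumR_eq_sum, ← Finset.Ico_add_one_right_eq_Icc, Finset.sum_Ico_eq_sum_range]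
    push_cast
    refine Finset.sum_congr (by simp) fun t _ => ?_
    rw [Nat.add_comm 1 t]
  rw [Finset.sum_congr rfl hC] at hR
  -- assemble
  simpa [hG, hR] using hSQ

/-- `isOut` is symmetric. [folklore] -/
theorem isOut_comm (p q : ℕ) : Z.isOut p q = Z.isOut q p := by
  unfold isOut; rw [Bool.or_comm]

/-- The in-classes: reduced ratios that stay in the window. [folklore] -/
def inClasses (Z : SOSData) : Finset (ℕ × ℕ) := (ratioClasses Z.Np).filter fun pq => Z.isOut pq.1 pq.2 = false

end SOSData

end Summit.RiemannHypothesis.RiemannHypothesis.Theorems.SignCone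

end
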